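import Mathlib.LinearAlgebra.Matrix.BilinearForm
import Mathlib.LinearAlgebra.FiniteDimensional.Lemmas
import Mathlib.Data.Nat.Find
import Mathlib.Data.Real.Basic
import HarnessLib

/-!
# Negative frames of a real symmetric matrix (index subadditivity engine)

pub-rhpf M2 seat, generation 8 — long-odds MECHANISM SEARCH; no RH claims.  This file is PURE LINEAR
ALGEBRA (no zeta, no Weil form): it is the finite-dimensional engine behind the parity decoupling of the
window negative index (`PfPersistenceM2ParitySplitting`).

* `exists_negFrame_nonnegFrame` — for a real symmetric `n × n` matrix `M` with bilinear form
  `B = Matrix.toBilin' M` there are `i ≤ n`, an `i`-frame `u` on whose real span `B` is NEGATIVE DEFINITE,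
  and a linearly independent `(n - i)`-frame `w` on whose real span `B` is NONNEGATIVE.

Proof: take a negative frame `u` of maximal size `i` (negative frames are linearly independent, so
`i ≤ n`; `Nat.findGreatest`); the kernel of `c ↦ (B c uₖ)ₖ` has dimension `≥ n - i` (rank–nullity) and
`B c c ≥ 0` on it, since a kernel vector with `B c c < 0` would extend `u` to a negative frame of size
`i + 1` (`B`-orthogonality kills the cross term).  Used with `M` = the polar matrix of `Re Q` on the even
parts of a real negative family: the complementary frame is then negative for the ODD parts.

All statements RH-free, sorry-free, unconditional. [folklore]
-/

open Finset Module

namespace Summit.RiemannHypothesis.RiemannHypothesis.Theorems.PfPersistenceM2NegIndex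

/-- The bilinear form of a symmetric matrix is symmetric. [folklore] -/
theorem toBilin'_comm_of_isSymm {n : ℕ} {M : Matrix (Fin n) (Fin n) ℝ} (hM : M.IsSymm)
    (x y : Fin n → ℝ) : Matrix.toBilin' M x y = Matrix.toBilin' M y x := by
  rw [Matrix.toBilin'_apply, Matrix.toBilin'_apply, Finset.sum_comm]
  refine Finset.sum_congr rfl fun a _ ↦ Finset.sum_congr rfl fun b _ ↦ ?_
  rw [← hM.apply a b]
  ring

/-- Binomial expansion of the quadratic form of a symmetric matrix. [folklore] -/
theorem toBilin'_add_smul_self_of_isSymm {n : ℕ} {M : Matrix (Fin n) (Fin n) ℝ} (hM : M.IsSymm)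
    (x c : Fin n → ℝ) (t : ℝ) :
    Matrix.toBilin' M (x + t • c) (x + t • c) =
      Matrix.toBilin' M x x + 2 * t * Matrix.toBilin' M x c + t ^ 2 * Matrix.toBilin' M c c := by
  simp only [map_add, map_smul, LinearMap.add_apply, LinearMap.smul_apply, smul_eq_mul]
  rw [toBilin'_comm_of_isSymm hM c x]
  ring

/-- The form against a finite combination in the first slot. [folklore] -/
theorem toBilin'_sum_smul_left {n k : ℕ} (M : Matrix (Fin n) (Fin n) ℝ) (d : Fin k → ℝ)
    (u : Fin k → Fin n → ℝ) (c : Fin n → ℝ) :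
    Matrix.toBilin' M (∑ l, d l • u l) c = ∑ l, d l * Matrix.toBilin' M (u l) c := by
  simp only [map_sum, map_smul, LinearMap.coe_sum, Finset.sum_apply, LinearMap.smul_apply,
    smul_eq_mul]

/-- A frame on whose span a bilinear form is negative definite is linearly independent. [folklore] -/
theorem linearIndependent_of_negFrame {n k : ℕ} (M : Matrix (Fin n) (Fin n) ℝ) {u : Fin k → Fin n → ℝ}
    (hu : ∀ d : Fin k → ℝ, d ≠ 0 → Matrix.toBilin' M (∑ l, d l • u l) (∑ l, d l • u l) < 0) :
    LinearIndependent ℝ u := by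
  rw [Fintype.linearIndependent_iff]
  intro d hd0
  by_contra hne
  have hd : d ≠ 0 := fun h ↦ hne fun l ↦ by simp [h]
  have h := hu d hd
  simp only [hd0, map_zero] at h
  exact lt_irrefl _ h

/-- **Negative / nonnegative frames of a real symmetric matrix (index subadditivity engine).**  For a real
symmetric `n × n` matrix `M` there are `i ≤ n`, an `i`-frame `u` on whose real span `c ↦ cᵀ M c` is negative
definite, and a linearly independent `(n - i)`-frame `w` on whose real span it is nonnegative. [folklore] -/
theorem exists_negFrame_nonnegFrame {n : ℕ} (M : Matrix (Fin n) (Fin n) ℝ) (hM : M.IsSymm) :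
    ∃ i ≤ n, ∃ u : Fin i → Fin n → ℝ, ∃ w : Fin (n - i) → Fin n → ℝ,
      (∀ d : Fin i → ℝ, d ≠ 0 →
        Matrix.toBilin' M (∑ k, d k • u k) (∑ k, d k • u k) < 0) ∧
      (∀ d : Fin (n - i) → ℝ, d ≠ 0 → (∑ l, d l • w l) ≠ 0) ∧
      (∀ d : Fin (n - i) → ℝ, 0 ≤ Matrix.toBilin' M (∑ l, d l • w l) (∑ l, d l • w l)) := by
  classical
  set B := Matrix.toBilin' M with hB
  -- `P i`: there is a negative frame of size `i`
  let P : ℕ → Prop := fun i ↦ ∃ u : Fin i → Fin n → ℝ,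
    ∀ d : Fin i → ℝ, d ≠ 0 → B (∑ k, d k • u k) (∑ k, d k • u k) < 0
  have hP0 : P 0 := ⟨fun k ↦ k.elim0, fun d hd ↦ absurd (Subsingleton.elim d 0) hd⟩
  have hPle : ∀ i, P i → i ≤ n := by
    rintro i ⟨u, hu⟩
    have hli := linearIndependent_of_negFrame M hu
    simpa using hli.fintype_card_le_finrank
  set i₀ := Nat.findGreatest P n with hi₀
  have hi₀le : i₀ ≤ n := Nat.findGreatest_le n
  have hPi₀ : P i₀ := Nat.findGreatest_spec (Nat.zero_le n) hP0
  have hnot : ¬ P (i₀ + 1) := by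
    intro h
    rcases Nat.lt_or_ge i₀ n with hlt | hge
    · exact Nat.findGreatest_is_greatest (Nat.lt_succ_self i₀) (Nat.succ_le_of_lt hlt) h
    · have := hPle _ h
      omega
  obtain ⟨u, hu⟩ := hPi₀
  -- the `B`-orthogonal complement of the frame `u`, as the kernel of a linear map
  let T : (Fin n → ℝ) →ₗ[ℝ] (Fin i₀ → ℝ) := LinearMap.pi fun k ↦ B.flip (u k)
  have hT : ∀ c k, T c k = B c (u k) := fun c k ↦ rfl
  have hker : ∀ c ∈ LinearMap.ker T, ∀ k, B c (u k) = 0 := fun c hc k ↦ by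
    rw [← hT]
    exact congrFun (LinearMap.mem_ker.1 hc) k
  have hrank : n - i₀ ≤ finrank ℝ (LinearMap.ker T) := by
    have h1 := LinearMap.finrank_range_add_finrank_ker T
    have h2 : finrank ℝ (LinearMap.range T) ≤ i₀ := by
      simpa using (LinearMap.range T).finrank_le
    rw [Module.finrank_fin_fun] at h1
    omega
  -- on the kernel the form is nonnegative, by maximality of `i₀`
  have hnonneg : ∀ c ∈ LinearMap.ker T, 0 ≤ B c c := by
    intro c hc
    by_contra hneg'
    have hneg : B c c < 0 := lt_of_not_ge hneg'
    apply hnot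
    refine ⟨Fin.snoc u c, fun d hd ↦ ?_⟩
    rw [Fin.sum_univ_castSucc]
    simp only [Fin.snoc_castSucc, Fin.snoc_last]
    set x : Fin n → ℝ := ∑ k : Fin i₀, d (Fin.castSucc k) • u k with hx
    set t : ℝ := d (Fin.last i₀) with ht
    have hxc : B x c = 0 := by
      rw [hx, toBilin'_sum_smul_left]
      refine Finset.sum_eq_zero fun k _ ↦ ?_
      rw [toBilin'_comm_of_isSymm hM (u k) c, hker c hc k, mul_zero]
    rw [toBilin'_add_smul_self_of_isSymm hM, hxc, mul_zero, add_zero]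
    by_cases hdi : (fun k : Fin i₀ ↦ d (Fin.castSucc k)) = 0
    · have hx0 : x = 0 := by
        rw [hx]
        exact Finset.sum_eq_zero fun k _ ↦ by
          rw [show d (Fin.castSucc k) = 0 from congrFun hdi k, zero_smul]
      have htne : t ≠ 0 := by
        intro h0
        apply hd
        funext k
        refine Fin.lastCases ?_ (fun j ↦ ?_) k
        · exact h0
        · exact congrFun hdi j
      simp only [hx0, map_zero, zero_add]
      exact mul_neg_of_pos_of_neg (by positivity) hneg
    · have hxx : B x x < 0 := hu _ hdi
      nlinarith [sq_nonneg t, mul_nonneg (sq_nonneg t) (neg_nonneg.2 hneg.le)]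
  -- a basis of the kernel gives the independent nonnegative frame
  let b := Module.finBasis ℝ (LinearMap.ker T)
  let w : Fin (n - i₀) → Fin n → ℝ := fun l ↦ (b (Fin.castLE hrank l) : Fin n → ℝ)
  have hwmem : ∀ d : Fin (n - i₀) → ℝ, (∑ l, d l • w l) ∈ LinearMap.ker T :=
    fun d ↦ Submodule.sum_mem _ fun l _ ↦ Submodule.smul_mem _ _ (b _).2
  have hwli : LinearIndependent ℝ w := by
    have h1 : LinearIndependent ℝ (fun l : Fin (n - i₀) ↦ b (Fin.castLE hrank l)) :=
      b.linearIndependent.comp _ (Fin.castLE_injective hrank)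
    exact h1.map' (LinearMap.ker T).subtype (Submodule.ker_subtype _)
  refine ⟨i₀, hi₀le, u, w, hu, fun d hd h0 ↦ ?_, fun d ↦ hnonneg _ (hwmem d)⟩
  exact hd (funext fun l ↦ Fintype.linearIndependent_iff.1 hwli d h0 l)

end Summit.RiemannHypothesis.RiemannHypothesis.Theorems.PfPersistenceM2NegIndex
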